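import Summits.Ventures.PercRepro.ProfileMixedStep

/-!
# PercRepro — the CLEAN inductive step of `MAS` for a general antichain (p10, gen 0; S5, Proposition 2⁺)

`ProfileMixedStep.lean` proves the inductive step of the mixed-antichain profile-Hall form `MAS` when a non-loop `e`
lies in NO member or in EVERY member of the antichain `𝒜`.  This file proves the common generalisation: call `e`
CLEAN for `𝒜` if `{B ∖ {e} : B ∈ 𝒜}` is again an antichain (equivalently: no member `B′ ∋ e` has `B′ ∖ {e}` strictly
inside a member `B ∌ e`).  Then the shadow splits as `#∂_u 𝒜 = #∂^{M＼e}_u 𝒜₀ + #∂^{M／e}_{u−1} 𝒜₁` with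
`𝒜₀ = {B ∈ 𝒜 : e ∉ B}`, `𝒜₁ = {B ∖ {e} : B ∈ 𝒜}`, both antichains, and the two induction hypotheses pay every
member (`pi_le_delete_add_contract` for `e ∉ B`, `pi_le_contract_erase` for `e ∈ B`):

* `shadowLevel_delete_filter`, `injOn_erase_of_antichain`;
* **`mas_step_of_clean`** — the step; `mas_step_of_notMem` / `mas_step_of_mem` are its extreme cases.
The MIXED regime of S5 §4 is therefore exactly: antichains for which EVERY non-loop `e` is unclean (e.g. the tight
families `𝒜 = all q-subsets` of a free matroid).
-/

/-! ## The clean step for a general antichain: `e` «clean» for `𝒜` (Proposition 2⁺) -/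

open scoped Matroid

namespace PercRepro.Skew

open Finset ThmH Shadow Profile

variable {α : Type} [DecidableEq α] {M : Matroid α} [M.Finite] {e : α} {u : ℕ}

/-- The `M ＼ {e}`-shadow of `𝒜` is the `M ＼ {e}`-shadow of the members avoiding `e`. -/
theorem shadowLevel_delete_filter (𝒜 : Finset (Finset α)) :
    shadowLevel (M ＼ ({e} : Set α)) u 𝒜 = shadowLevel (M ＼ ({e} : Set α)) u (𝒜.filter (fun B => e ∉ B)) := by
  ext S
  rw [mem_shadowLevel, mem_shadowLevel, gr_delete']
  constructor
  · rintro ⟨hS, B, hB, hBS⟩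
    refine ⟨hS, B, Finset.mem_filter.2 ⟨hB, fun heB => ?_⟩, hBS⟩
    exact (Finset.mem_erase.1 (hS.1 (hBS heB))).1 rfl
  · rintro ⟨hS, B, hB, hBS⟩
    exact ⟨hS, B, (Finset.mem_filter.1 hB).1, hBS⟩

/-- On an antichain, `B ↦ B ∖ {e}` is injective. -/
theorem injOn_erase_of_antichain (𝒜 : Finset (Finset α))
    (hanti : ∀ B ∈ 𝒜, ∀ B' ∈ 𝒜, B ⊆ B' → B = B') :
    Set.InjOn (fun B => B.erase e) (𝒜 : Set (Finset α)) := by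
  intro B hB B' hB' h
  simp only at h
  by_cases heB : e ∈ B <;> by_cases heB' : e ∈ B'
  · rw [← Finset.insert_erase heB, ← Finset.insert_erase heB', h]
  · -- B ∖ e = B' with e ∉ B': then B' ⊆ B, so B' = B, contradiction with e ∈ B ∖ B'
    rw [Finset.erase_eq_of_notMem heB'] at h
    have : B' ⊆ B := by rw [← h]; exact Finset.erase_subset e B
    have hBB := hanti B' hB' B hB this
    subst hBB
    exact absurd heB heB'
  · rw [Finset.erase_eq_of_notMem heB] at h
    have : B ⊆ B' := by rw [h]; exact Finset.erase_subset e B'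
    have hBB := hanti B hB B' hB' this
    subst hBB
    exact absurd heB' heB
  · rw [Finset.erase_eq_of_notMem heB, Finset.erase_eq_of_notMem heB'] at h
    exact h

/-- **Proposition 2⁺ (the clean step)**: for a non-loop `e` and an antichain `𝒜` for which `e` is CLEAN — the family
`{B ∖ {e} : B ∈ 𝒜}` is again an antichain — the inequality for `(M, 𝒜, u)` follows from `MAS (M ＼ {e}) u` and
`MAS (M ／ {e}) (u − 1)`.  (`e` outside every member and `e` inside every member are the two extreme clean cases.) -/
theorem mas_step_of_clean (he : M.Indep {e}) (hu : 1 ≤ u) (h1 : MAS (M ＼ ({e} : Set α)) u)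
    (h2 : MAS (M ／ ({e} : Set α)) (u - 1)) (𝒜 : Finset (Finset α)) (h𝒜 : ∀ B ∈ 𝒜, B ⊆ gr M)
    (hanti : ∀ B ∈ 𝒜, ∀ B' ∈ 𝒜, B ⊆ B' → B = B')
    (hclean : ∀ B ∈ 𝒜, ∀ B' ∈ 𝒜, B.erase e ⊆ B'.erase e → B = B') :
    ∑ B ∈ 𝒜, pi M u B ≤ ((shadowLevel M u 𝒜).card : ℚ) := by
  set 𝒜₀ := 𝒜.filter (fun B => e ∉ B) with h𝒜₀
  set 𝒜₁ := 𝒜.image (fun B => B.erase e) with h𝒜₁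
  have hinj : Set.InjOn (fun B => B.erase e) (𝒜 : Set (Finset α)) := injOn_erase_of_antichain 𝒜 hanti
  -- the two induction hypotheses
  have hd := h1 𝒜₀
    (fun B hB => by
      rw [gr_delete']
      exact Finset.subset_erase.2 ⟨h𝒜 B (Finset.mem_filter.1 hB).1, (Finset.mem_filter.1 hB).2⟩)
    (fun B hB B' hB' hBB' => hanti B (Finset.mem_filter.1 hB).1 B' (Finset.mem_filter.1 hB').1 hBB')
  have hc := h2 𝒜₁
    (fun B' hB' => by
      rw [Finset.mem_image] at hB'
      obtain ⟨B, hB, rfl⟩ := hB'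
      rw [gr_contract']
      exact Finset.erase_subset_erase e (h𝒜 B hB))
    (fun B₁ hB₁ B₂ hB₂ hsub => by
      rw [Finset.mem_image] at hB₁ hB₂
      obtain ⟨B, hB, rfl⟩ := hB₁
      obtain ⟨B', hB', rfl⟩ := hB₂
      rw [hclean B hB B' hB' hsub])
  -- the shadow split
  have hsplit : (shadowLevel M u 𝒜).card =
      (shadowLevel (M ＼ ({e} : Set α)) u 𝒜₀).card + (shadowLevel (M ／ ({e} : Set α)) (u - 1) 𝒜₁).card := by
    rw [← Finset.card_filter_add_card_filter_not (s := shadowLevel M u 𝒜) (fun S => e ∉ S),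
      shadowLevel_filter_notMem, shadowLevel_delete_filter, ← card_shadowLevel_filter_mem he hu 𝒜]
    congr 2
    ext S
    simp only [Finset.mem_filter, not_not]
  -- the prices: members avoiding e are paid by both minors, members containing e by the contraction
  have hsum₁ : ∑ B' ∈ 𝒜₁, pi (M ／ ({e} : Set α)) (u - 1) B' =
      ∑ B ∈ 𝒜, pi (M ／ ({e} : Set α)) (u - 1) (B.erase e) := Finset.sum_image hinj
  have hsum₀ : ∑ B ∈ 𝒜, pi (M ＼ ({e} : Set α)) u B * (if e ∈ B then 0 else 1) =
      ∑ B ∈ 𝒜₀, pi (M ＼ ({e} : Set α)) u B := by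
    rw [h𝒜₀, Finset.sum_filter]
    apply Finset.sum_congr rfl
    intro B _
    split_ifs <;> simp
  have hpay : ∀ B ∈ 𝒜, pi M u B ≤
      pi (M ＼ ({e} : Set α)) u B * (if e ∈ B then 0 else 1) + pi (M ／ ({e} : Set α)) (u - 1) (B.erase e) := by
    intro B hB
    by_cases heB : e ∈ B
    · rw [if_pos heB, mul_zero, zero_add]
      exact pi_le_contract_erase he hu (h𝒜 B hB) heB
    · rw [if_neg heB, mul_one, Finset.erase_eq_of_notMem heB]
      exact pi_le_delete_add_contract he hu (h𝒜 B hB) heB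
  rw [hsplit, Nat.cast_add]
  calc ∑ B ∈ 𝒜, pi M u B
      ≤ ∑ B ∈ 𝒜, (pi (M ＼ ({e} : Set α)) u B * (if e ∈ B then 0 else 1) +
          pi (M ／ ({e} : Set α)) (u - 1) (B.erase e)) := Finset.sum_le_sum hpay
    _ = ∑ B ∈ 𝒜₀, pi (M ＼ ({e} : Set α)) u B + ∑ B' ∈ 𝒜₁, pi (M ／ ({e} : Set α)) (u - 1) B' := by
        rw [Finset.sum_add_distrib, hsum₀, hsum₁]
    _ ≤ _ := add_le_add hd hc

end PercRepro.Skew
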